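import Summits.HodgeConjecture.HodgeConjecture.Theorems.Ring2WeilCoverageNormClassEq
import Summits.HodgeConjecture.HodgeConjecture.Theorems.Ring2WeilCoverageNormTableB
import Summits.HodgeConjecture.HodgeConjecture.Theorems.Ring2WeilCoverageNormTableC
import HarnessLib

/-!
# Weil-type family coverage — TYPE-III WINDOWS OF HIGHER RANK (census block b04.17): `W6.11.13` and `W6.11.26` reached; curve-carried points of `T_ℍ(Δ)` on R1, R2, R4

research route conditional on HC_CM; not a corollary; Q11.4-sentence-2 already refuted in dim ≥ 3.

Ring 2, WEIL-TYPE FAMILY-COVERAGE CENSUS (`HOME/WEIL-FAMILY-COVERAGE.md` `## b04`, block b04.17, owner ring2-b04, gen 53; mirror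
`HOME/pub-hodge-ring2-b04/census-g53/`).  THE WINDOW (THEOREMS S14/S15 of the census): a RATIONAL faithful irreducible character `χ` of
`G = SL₂(p)` of Schur index 2 and degree `2r ≥ 4` — `χ_{p+1} = Ind_B^G α₄` (`p ≡ 5 mod 8`, `D_χ = (-1,-p)_ℚ = D_{2,∞} ≅ ℍ_ℚ`),
`Ind_B^G α₆` (`p ≡ 7 mod 12`, `D_χ = (-3,-p)_ℚ = D_{3,∞}`), the cuspidal `θ_{β₄}` (`p ≡ 3 mod 8`, `D_{2,∞}`) —; for a `G`-curve `C̃` with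
`m := ⟨H¹(C̃), χ⟩ = 6` (Chevalley–Weil; S15 lists ALL such signatures: `SL₂(5)`, `SL₂(13)`; `SL₂(7)`, `SL₂(19)`, `SL₂(31)`; `SL₂(11)`,
`SL₂(19)`; `SL₂(17)`, `SL₂(29)`) the `χ`-isotypic abelian subvariety is `P ~ B^r` and the HIDDEN FACTOR `B` is an abelian SIXFOLD with
`H¹(B;ℚ) ≅ D³` — a TYPE-III point, of Weil type `(3,3)` for EVERY imaginary quadratic `K ⊂ D` (census b04.10 (A)), on the row
`(3, K, [c_K·Δ(B)])`, `Δ(B)` the reduced-norm discriminant of the rank-3 skew-hermitian `D`-form (= the frame-free invariant of b04.10 =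
pub-hsemireg MT-TYPES-g6 §8.3).  ENGINE `t3win.py` (exact; stdlib): the coset curve `Y = H\\C̃` (`H = U` resp. `C₅`, `χ^H` 2-dimensional,
`-1 ∉ H`), `H¹(Y;ℚ)` with its cup form (polygon model of ring2-b02's `qcover.py`), the HECKE CORRESPONDENCES `T_g : Hx ↦ Σ_{Hγ⊂HgH} Hγx`
(endomorphisms of `J(Y)`), the `χ`-projector `e_χ = (χ(1)/(|G||H|)) Σ_{HyH} (Σ_{h,h'} χ(h'y⁻¹h)) T*_{y⁻¹}`, `V = e_χH¹(Y;ℚ) = H¹(B;ℚ)` on which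
the Hecke algebra acts through `D ⊂ End⁰(B)`; the `K`-frames are Hecke operators `x` with `x² = -d`; `H(v,w) = E(v,xw) + θE(v,w)`
[vG94 5.2], `a = -det_K H`.  RESULTS of this part: the FIRST curve-carried members of the residual rows `W6.11.13` and `W6.11.26` of
census b02.24.5 / b04.16 (rigid `SL₂(13)`-curves; reach of the census 37 → 39 of 50), curve-carried points of the type-III loci
`T_ℍ(Δ ≡ 1)` (pub-hsemireg's printed-HC locus on R1) on `R1 = W6.3.2` and `R4 = W6.11.2`, one-parameter `2I`-families on `R2 = W6.3.5`
and `W6.2.5`, and `SL₂(7)` type-III points on `W6.1.21` / `W6.7.3`.  The `ℚ(√-11)` row keys `13, 26 ∉ Nm` are the tree's `SqrtNeg11.not_mem_13 / not_mem_26` (census b04.2, parts NormTableB/C).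

No `def`, no named fact, no `sorry`; nothing here is a statement about Hodge classes; `HC_CM` is used nowhere.
References: [cite: vanGeemen1994HodgeAV, (5.4.1), Lemma 5.2]; [cite: Serre1973, Ch. III §1].
-/

set_option linter.dupNamespace false

open Literature.AlgebraicGeometry.Motives
open Literature.AlgebraicGeometry.VanGeemen1994
open Summit.HodgeConjecture.HodgeConjecture.Ring2.Hypotheses

namespace Summit.HodgeConjecture.HodgeConjecture.Ring2.WeilCoverage

-- Row keys `13, 26 ∉ Nm(ℚ(√-11)ˣ)`: `SqrtNeg11.not_mem_13` (NormTableB, p331286) and `SqrtNeg11.not_mem_26` (NormTableC, p331287) are in the tree and imported.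

/-! ### §1 `SL₂(13)`, `χ₁₄`: the residual rows `W6.11.13`, `W6.11.26` (and `W6.2.13`, R1) -/

/-- TYPE-III WINDOW datum (census b04.17; engine `t3win.py`, exact): `G = SL₂(13)`, carrier `χ_{14} = Ind_B^G α₄` (rational, faithful, Schur index 2; `D_χ = (-1,-13)_Q`, finite ramification `[2]` — Hamilton's `ℍ_ℚ`), branch classes `(4A,13A,3A)` (orders `4,13,3`; `C̃` of genus 372); coset curve `Y = U\\C̃` of degree 168 and genus 24; `V = e_χ H¹(Y;ℚ) = H¹(B;ℚ)` (dimension 12; `B` the `χ`-HIDDEN FACTOR, an abelian SIXFOLD with `End⁰(B) ⊇ D` — TYPE III —, the Hecke image on `V` is `D` itself); for `K = ℚ(√-11) ⊂ D` the frame is the Hecke operator `x = 3·I + 1/13·J + 5/13·IJ` (`x² = -11`), `K`-signature `(3,3)` — WEIL TYPE —, literal `det H|_B = -41290560/13`, `a = 41290560/13`, `T(a) = [11, 13]`: row `W6.11.13` (NON-split); frame-free invariant `C = Nrd(cᵗ) = 729/26` (`Δ ≡ 26`; MT-TYPES-g6 §8.3: `δ(B,K) ≡ c_K·Δ`).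
research route conditional on HC_CM; not a corollary; Q11.4-sentence-2 already refuted in dim ≥ 3. [cite: vanGeemen1994HodgeAV, (5.4.1)] -/
theorem t3_sl2_13_4A13A3A_d11_mk_detH_ne_split :
    (QuotientGroup.mk (Units.mk0 (((-41290560 : ℚ) / 13)) (by norm_num)) : weilNormResidueGroup 11) ≠
      splitDiscriminantClass 3 11 := by
  have e : Units.mk0 (((-41290560 : ℚ) / 13)) (by norm_num) = -(Units.mk0 ((41290560 : ℚ) / 13) (by norm_num)) := Units.ext (by norm_num)
  rw [Ne, e, mk_neg_eq_splitDiscriminantClass_iff_of_odd (n := 3) (by decide)]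
  have h := mul_not_mem_normUnitsSubgroup (mem_normUnitsSubgroup_of_sq_add_mul_sq (d := 11) (a := ((41290560 : ℚ) / 169)) (by norm_num) ((-4428 : ℚ) / 13) (108 : ℚ) (by norm_num))
    SqrtNeg11.not_mem_13
  rw [mk0_mul_mk0] at h
  norm_num at h
  exact h

/-- The same datum, CELL IDENTIFICATION: `[det H|_B] = [-13]` in `ℚˣ/Nm(ℚ(√-11)ˣ)` — the census ROW KEY of `W6.11.13` (`a·13 = (41290560 : ℚ) = ((-4428 : ℚ))² + 11·((1404 : ℚ))²`).
research route conditional on HC_CM; not a corollary; Q11.4-sentence-2 already refuted in dim ≥ 3. [cite: vanGeemen1994HodgeAV, Lemma 5.2 (3)] -/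
theorem t3_sl2_13_4A13A3A_d11_mk_detH_eq_key :
    (QuotientGroup.mk (Units.mk0 (-(((41290560 : ℚ) / 13))) (neg_ne_zero.2 (by norm_num))) : weilNormResidueGroup 11) =
      QuotientGroup.mk (Units.mk0 (-(13 : ℚ)) (neg_ne_zero.2 (by norm_num))) :=
  mk_neg_eq_mk_neg_of_mul_mem (by norm_num) (by norm_num)
    (mem_normUnitsSubgroup_of_sq_add_mul_sq _ (-4428 : ℚ) (1404 : ℚ) (by norm_num))

/-- TYPE-III WINDOW datum (census b04.17; engine `t3win.py`, exact): `G = SL₂(13)`, carrier `χ_{14} = Ind_B^G α₄` (rational, faithful, Schur index 2; `D_χ = (-1,-13)_Q`, finite ramification `[2]` — Hamilton's `ℍ_ℚ`), branch classes `(4A,13A,3A)` (orders `4,13,3`; `C̃` of genus 372); coset curve `Y = U\\C̃` of degree 168 and genus 24; `V = e_χ H¹(Y;ℚ) = H¹(B;ℚ)` (dimension 12; `B` the `χ`-HIDDEN FACTOR, an abelian SIXFOLD with `End⁰(B) ⊇ D` — TYPE III —, the Hecke image on `V` is `D` itself); for `K = ℚ(√-2) ⊂ D` the frame is the Hecke operator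 `x = 0·I + 1/13·J + 5/13·IJ` (`x² = -2`), `K`-signature `(3,3)` — WEIL TYPE —, literal `det H|_B = -39366/13`, `a = 39366/13`, `T(a) = [2, 13]`: row `W6.2.13` (NON-split); frame-free invariant `C = Nrd(cᵗ) = 729/26` (`Δ ≡ 26`; MT-TYPES-g6 §8.3: `δ(B,K) ≡ c_K·Δ`).
research route conditional on HC_CM; not a corollary; Q11.4-sentence-2 already refuted in dim ≥ 3. [cite: vanGeemen1994HodgeAV, (5.4.1)] -/
theorem t3_sl2_13_4A13A3A_d2_mk_detH_ne_split :
    (QuotientGroup.mk (Units.mk0 (((-39366 : ℚ) / 13)) (by norm_num)) : weilNormResidueGroup 2) ≠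
      splitDiscriminantClass 3 2 := by
  have e : Units.mk0 (((-39366 : ℚ) / 13)) (by norm_num) = -(Units.mk0 ((39366 : ℚ) / 13) (by norm_num)) := Units.ext (by norm_num)
  rw [Ne, e, mk_neg_eq_splitDiscriminantClass_iff_of_odd (n := 3) (by decide)]
  have h := mul_not_mem_normUnitsSubgroup (mem_normUnitsSubgroup_of_sq_add_mul_sq (d := 2) (a := ((39366 : ℚ) / 169)) (by norm_num) ((-162 : ℚ) / 13) ((81 : ℚ) / 13) (by norm_num))
    Summit.HodgeConjecture.Ring2WeilNormDescent.thirteen_not_mem_norm_two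
  rw [mk0_mul_mk0] at h
  norm_num at h
  exact h

/-- The same datum, CELL IDENTIFICATION: `[det H|_B] = [-13]` in `ℚˣ/Nm(ℚ(√-2)ˣ)` — the census ROW KEY of `W6.2.13` (`a·13 = (39366 : ℚ) = ((-162 : ℚ))² + 2·((81 : ℚ))²`).
research route conditional on HC_CM; not a corollary; Q11.4-sentence-2 already refuted in dim ≥ 3. [cite: vanGeemen1994HodgeAV, Lemma 5.2 (3)] -/
theorem t3_sl2_13_4A13A3A_d2_mk_detH_eq_key :
    (QuotientGroup.mk (Units.mk0 (-(((39366 : ℚ) / 13))) (neg_ne_zero.2 (by norm_num))) : weilNormResidueGroup 2) =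
      QuotientGroup.mk (Units.mk0 (-(13 : ℚ)) (neg_ne_zero.2 (by norm_num))) :=
  mk_neg_eq_mk_neg_of_mul_mem (by norm_num) (by norm_num)
    (mem_normUnitsSubgroup_of_sq_add_mul_sq _ (-162 : ℚ) (81 : ℚ) (by norm_num))

/-- TYPE-III WINDOW datum (census b04.17; engine `t3win.py`, exact): `G = SL₂(13)`, carrier `χ_{14} = Ind_B^G α₄` (rational, faithful, Schur index 2; `D_χ = (-1,-13)_Q`, finite ramification `[2]` — Hamilton's `ℍ_ℚ`), branch classes `(13A,14C,3A)` (orders `13,14,3`; `C̃` of genus 567); coset curve `Y = U\\C̃` of degree 168 and genus 39; `V = e_χ H¹(Y;ℚ) = H¹(B;ℚ)` (dimension 12; `B` the `χ`-HIDDEN FACTOR, an abelian SIXFOLD with `End⁰(B) ⊇ D` — TYPE III —, the Hecke image on `V` is `D` itself); for `K = ℚ(√-11) ⊂ D` the frame is the Hecke operator `x = 3·I + 1/13·J + 5/13·IJ` (`x² = -11`), `K`-signature `(3,3)` — WEIL TYPE —, literal `det H|_B = -111974400/13`, `a = 111974400/13`, `T(a) = [2, 13]`: row `W6.11.26` (NON-split);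 frame-free invariant `C = Nrd(cᵗ) = 26244/13` (`Δ ≡ 13`; MT-TYPES-g6 §8.3: `δ(B,K) ≡ c_K·Δ`).
research route conditional on HC_CM; not a corollary; Q11.4-sentence-2 already refuted in dim ≥ 3. [cite: vanGeemen1994HodgeAV, (5.4.1)] -/
theorem t3_sl2_13_13A14C3A_d11_mk_detH_ne_split :
    (QuotientGroup.mk (Units.mk0 (((-111974400 : ℚ) / 13)) (by norm_num)) : weilNormResidueGroup 11) ≠
      splitDiscriminantClass 3 11 := by
  have e : Units.mk0 (((-111974400 : ℚ) / 13)) (by norm_num) = -(Units.mk0 ((111974400 : ℚ) / 13) (by norm_num)) := Units.ext (by norm_num)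
  rw [Ne, e, mk_neg_eq_splitDiscriminantClass_iff_of_odd (n := 3) (by decide)]
  have h := mul_not_mem_normUnitsSubgroup (mem_normUnitsSubgroup_of_sq_add_mul_sq (d := 11) (a := ((55987200 : ℚ) / 169)) (by norm_num) ((2160 : ℚ) / 13) ((2160 : ℚ) / 13) (by norm_num))
    SqrtNeg11.not_mem_26
  rw [mk0_mul_mk0] at h
  norm_num at h
  exact h

/-- The same datum, CELL IDENTIFICATION: `[det H|_B] = [-26]` in `ℚˣ/Nm(ℚ(√-11)ˣ)` — the census ROW KEY of `W6.11.26` (`a·26 = (223948800 : ℚ) = ((4320 : ℚ))² + 11·((4320 : ℚ))²`).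
research route conditional on HC_CM; not a corollary; Q11.4-sentence-2 already refuted in dim ≥ 3. [cite: vanGeemen1994HodgeAV, Lemma 5.2 (3)] -/
theorem t3_sl2_13_13A14C3A_d11_mk_detH_eq_key :
    (QuotientGroup.mk (Units.mk0 (-(((111974400 : ℚ) / 13))) (neg_ne_zero.2 (by norm_num))) : weilNormResidueGroup 11) =
      QuotientGroup.mk (Units.mk0 (-(26 : ℚ)) (neg_ne_zero.2 (by norm_num))) :=
  mk_neg_eq_mk_neg_of_mul_mem (by norm_num) (by norm_num)
    (mem_normUnitsSubgroup_of_sq_add_mul_sq _ (4320 : ℚ) (4320 : ℚ) (by norm_num))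

/-- TYPE-III WINDOW datum (census b04.17; engine `t3win.py`, exact): `G = SL₂(13)`, carrier `χ_{14} = Ind_B^G α₄` (rational, faithful, Schur index 2; `D_χ = (-1,-13)_Q`, finite ramification `[2]` — Hamilton's `ℍ_ℚ`), branch classes `(13A,14C,3A)` (orders `13,14,3`; `C̃` of genus 567); coset curve `Y = U\\C̃` of degree 168 and genus 39; `V = e_χ H¹(Y;ℚ) = H¹(B;ℚ)` (dimension 12; `B` the `χ`-HIDDEN FACTOR, an abelian SIXFOLD with `End⁰(B) ⊇ D` — TYPE III —, the Hecke image on `V` is `D` itself); for `K = ℚ(√-3) ⊂ D` the frame is the Hecke operator `x = 1/3·I + 1/3·J + 1/3·IJ` (`x² = -3`), `K`-signature `(3,3)` — WEIL TYPE —, literal `det H|_B = -350208`, `a = 350208`, `T(a) = [2, 3]`: row `W6.3.2` (NON-split); frame-free invariant `C = Nrd(cᵗ) = 26244/13` (`Δ ≡ 13`; MT-TYPES-g6 §8.3: `δ(B,K) ≡ c_K·Δ`).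
research route conditional on HC_CM; not a corollary; Q11.4-sentence-2 already refuted in dim ≥ 3. [cite: vanGeemen1994HodgeAV, (5.4.1)] -/
theorem t3_sl2_13_13A14C3A_d3_mk_detH_ne_split :
    (QuotientGroup.mk (Units.mk0 ((-350208 : ℚ)) (by norm_num)) : weilNormResidueGroup 3) ≠
      splitDiscriminantClass 3 3 := by
  have e : Units.mk0 ((-350208 : ℚ)) (by norm_num) = -(Units.mk0 (350208 : ℚ) (by norm_num)) := Units.ext (by norm_num)
  rw [Ne, e, mk_neg_eq_splitDiscriminantClass_iff_of_odd (n := 3) (by decide)]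
  have h := mul_not_mem_normUnitsSubgroup (mem_normUnitsSubgroup_of_sq_add_mul_sq (d := 3) (a := (175104 : ℚ)) (by norm_num) (384 : ℚ) (96 : ℚ) (by norm_num))
    Summit.HodgeConjecture.Ring2WeilNormDescent.two_not_mem_norm_three
  rw [mk0_mul_mk0] at h
  norm_num at h
  exact h

/-- The same datum, CELL IDENTIFICATION: `[det H|_B] = [-2]` in `ℚˣ/Nm(ℚ(√-3)ˣ)` — the census ROW KEY of `W6.3.2` (`a·2 = (700416 : ℚ) = ((768 : ℚ))² + 3·((192 : ℚ))²`).
research route conditional on HC_CM; not a corollary; Q11.4-sentence-2 already refuted in dim ≥ 3. [cite: vanGeemen1994HodgeAV, Lemma 5.2 (3)] -/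
theorem t3_sl2_13_13A14C3A_d3_mk_detH_eq_key :
    (QuotientGroup.mk (Units.mk0 (-((350208 : ℚ))) (neg_ne_zero.2 (by norm_num))) : weilNormResidueGroup 3) =
      QuotientGroup.mk (Units.mk0 (-(2 : ℚ)) (neg_ne_zero.2 (by norm_num))) :=
  mk_neg_eq_mk_neg_of_mul_mem (by norm_num) (by norm_num)
    (mem_normUnitsSubgroup_of_sq_add_mul_sq _ (768 : ℚ) (192 : ℚ) (by norm_num))

/-- TYPE-III WINDOW datum (census b04.17; engine `t3win.py`, exact): `G = SL₂(13)`, carrier `χ_{14} = Ind_B^G α₄` (rational, faithful, Schur index 2; `D_χ = (-1,-13)_Q`, finite ramification `[2]` — Hamilton's `ℍ_ℚ`), branch classes `(6A,7A,3A)` (orders `6,7,3`; `C̃` of genus 391); coset curve `Y = U\\C̃` of degree 168 and genus 31; `V = e_χ H¹(Y;ℚ) = H¹(B;ℚ)` (dimension 12; `B` the `χ`-HIDDEN FACTOR, an abelian SIXFOLD with `End⁰(B) ⊇ D` — TYPE III —, the Hecke image on `V` is `D` itself); for `K = ℚ(√-3) ⊂ D` the frame is the Hecke operator `x = 1/3·I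 + 1/3·J + 1/3·IJ` (`x² = -3`), `K`-signature `(3,3)` — WEIL TYPE —, literal `det H|_B = -59904`, `a = 59904`, `T(a) = [2, 3]`: row `W6.3.2` (NON-split); frame-free invariant `C = Nrd(cᵗ) = 59049/676` (`Δ ≡ 1`; MT-TYPES-g6 §8.3: `δ(B,K) ≡ c_K·Δ`). This `B` is a point of the type-III locus `T_ℍ(Δ ≡ 1)` — on R1 = `W6.3.2` the PRINTED-HC locus of pub-hsemireg MT-TYPES-g6 §8.4 (R1) [Abd16 App. A 2(b)]; count and pens theirs.
research route conditional on HC_CM; not a corollary; Q11.4-sentence-2 already refuted in dim ≥ 3. [cite: vanGeemen1994HodgeAV, (5.4.1)] -/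
theorem t3_sl2_13_6A7A3A_d3_mk_detH_ne_split :
    (QuotientGroup.mk (Units.mk0 ((-59904 : ℚ)) (by norm_num)) : weilNormResidueGroup 3) ≠
      splitDiscriminantClass 3 3 := by
  have e : Units.mk0 ((-59904 : ℚ)) (by norm_num) = -(Units.mk0 (59904 : ℚ) (by norm_num)) := Units.ext (by norm_num)
  rw [Ne, e, mk_neg_eq_splitDiscriminantClass_iff_of_odd (n := 3) (by decide)]
  have h := mul_not_mem_normUnitsSubgroup (mem_normUnitsSubgroup_of_sq_add_mul_sq (d := 3) (a := (29952 : ℚ)) (by norm_num) (168 : ℚ) (24 : ℚ) (by norm_num))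
    Summit.HodgeConjecture.Ring2WeilNormDescent.two_not_mem_norm_three
  rw [mk0_mul_mk0] at h
  norm_num at h
  exact h

/-- The same datum, CELL IDENTIFICATION: `[det H|_B] = [-2]` in `ℚˣ/Nm(ℚ(√-3)ˣ)` — the census ROW KEY of `W6.3.2` (`a·2 = (119808 : ℚ) = ((336 : ℚ))² + 3·((48 : ℚ))²`).
research route conditional on HC_CM; not a corollary; Q11.4-sentence-2 already refuted in dim ≥ 3. [cite: vanGeemen1994HodgeAV, Lemma 5.2 (3)] -/
theorem t3_sl2_13_6A7A3A_d3_mk_detH_eq_key :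
    (QuotientGroup.mk (Units.mk0 (-((59904 : ℚ))) (neg_ne_zero.2 (by norm_num))) : weilNormResidueGroup 3) =
      QuotientGroup.mk (Units.mk0 (-(2 : ℚ)) (neg_ne_zero.2 (by norm_num))) :=
  mk_neg_eq_mk_neg_of_mul_mem (by norm_num) (by norm_num)
    (mem_normUnitsSubgroup_of_sq_add_mul_sq _ (336 : ℚ) (48 : ℚ) (by norm_num))

/-- TYPE-III WINDOW datum (census b04.17; engine `t3win.py`, exact): `G = SL₂(13)`, carrier `χ_{14} = Ind_B^G α₄` (rational, faithful, Schur index 2; `D_χ = (-1,-13)_Q`, finite ramification `[2]` — Hamilton's `ℍ_ℚ`), branch classes `(6A,7A,3A)` (orders `6,7,3`; `C̃` of genus 391); coset curve `Y = U\\C̃` of degree 168 and genus 31; `V = e_χ H¹(Y;ℚ) = H¹(B;ℚ)` (dimension 12; `B` the `χ`-HIDDEN FACTOR, an abelian SIXFOLD with `End⁰(B) ⊇ D` — TYPE III —, the Hecke image on `V` is `D` itself); for `K = ℚ(√-11) ⊂ D` the frame is the Hecke operator `x = 3·I + 1/13·J + 5/13·IJ` (`x² = -11`), `K`-signature `(3,3)`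 — WEIL TYPE —, literal `det H|_B = -25754112/169`, `a = 25754112/169`, `T(a) = [2, 11]`: row `W6.11.2` (NON-split); frame-free invariant `C = Nrd(cᵗ) = 59049/676` (`Δ ≡ 1`; MT-TYPES-g6 §8.3: `δ(B,K) ≡ c_K·Δ`). This `B` is a point of the type-III locus `T_ℍ(Δ ≡ 1)` — on R1 = `W6.3.2` the PRINTED-HC locus of pub-hsemireg MT-TYPES-g6 §8.4 (R1) [Abd16 App. A 2(b)]; count and pens theirs.
research route conditional on HC_CM; not a corollary; Q11.4-sentence-2 already refuted in dim ≥ 3. [cite: vanGeemen1994HodgeAV, (5.4.1)] -/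
theorem t3_sl2_13_6A7A3A_d11_mk_detH_ne_split :
    (QuotientGroup.mk (Units.mk0 (((-25754112 : ℚ) / 169)) (by norm_num)) : weilNormResidueGroup 11) ≠
      splitDiscriminantClass 3 11 := by
  have e : Units.mk0 (((-25754112 : ℚ) / 169)) (by norm_num) = -(Units.mk0 ((25754112 : ℚ) / 169) (by norm_num)) := Units.ext (by norm_num)
  rw [Ne, e, mk_neg_eq_splitDiscriminantClass_iff_of_odd (n := 3) (by decide)]
  have h := mul_not_mem_normUnitsSubgroup (mem_normUnitsSubgroup_of_sq_add_mul_sq (d := 11) (a := ((12877056 : ℚ) / 169)) (by norm_num) ((-216 : ℚ) / 13) ((1080 : ℚ) / 13) (by norm_num))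
    Summit.HodgeConjecture.Ring2WeilNormDescent.two_not_mem_norm_eleven
  rw [mk0_mul_mk0] at h
  norm_num at h
  exact h

/-- The same datum, CELL IDENTIFICATION: `[det H|_B] = [-2]` in `ℚˣ/Nm(ℚ(√-11)ˣ)` — the census ROW KEY of `W6.11.2` (`a·2 = ((51508224 : ℚ) / 169) = (((-432 : ℚ) / 13))² + 11·(((2160 : ℚ) / 13))²`).
research route conditional on HC_CM; not a corollary; Q11.4-sentence-2 already refuted in dim ≥ 3. [cite: vanGeemen1994HodgeAV, Lemma 5.2 (3)] -/
theorem t3_sl2_13_6A7A3A_d11_mk_detH_eq_key :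
    (QuotientGroup.mk (Units.mk0 (-(((25754112 : ℚ) / 169))) (neg_ne_zero.2 (by norm_num))) : weilNormResidueGroup 11) =
      QuotientGroup.mk (Units.mk0 (-(2 : ℚ)) (neg_ne_zero.2 (by norm_num))) :=
  mk_neg_eq_mk_neg_of_mul_mem (by norm_num) (by norm_num)
    (mem_normUnitsSubgroup_of_sq_add_mul_sq _ ((-432 : ℚ) / 13) ((2160 : ℚ) / 13) (by norm_num))

/-! ### §2 `SL₂(5) = 2I`, `χ₆`: points of `T_ℍ(Δ≡1)` on R1 / R4 and the one-parameter families on R2 / `W6.2.5` -/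

/-- TYPE-III WINDOW datum (census b04.17; engine `t3win.py`, exact): `G = SL₂(5)`, carrier `χ_{6} = Ind_B^G α₄` (rational, faithful, Schur index 2; `D_χ = (-1,-5)_Q`, finite ramification `[2]` — Hamilton's `ℍ_ℚ`), branch classes `(6A,6A,10A)` (orders `6,6,10`; `C̃` of genus 35); coset curve `Y = U\\C̃` of degree 24 and genus 7; `V = e_χ H¹(Y;ℚ) = H¹(B;ℚ)` (dimension 12; `B` the `χ`-HIDDEN FACTOR, an abelian SIXFOLD with `End⁰(B) ⊇ D` — TYPE III —, the Hecke image on `V` is `D` itself); for `K = ℚ(√-3) ⊂ D` the frame is the Hecke operator `x = 1·I + 1/5·J + 3/5·IJ` (`x² = -3`), `K`-signature `(3,3)` — WEIL TYPE —, literal `det H|_B = -416/25`, `a = 416/25`, `T(a) = [2, 3]`: row `W6.3.2` (NON-split); frame-free invariant `C = Nrd(cᵗ) = 9/400` (`Δ ≡ 1`; MT-TYPES-g6 §8.3: `δ(B,K) ≡ c_K·Δ`). This `B` is a point of the type-III locus `T_ℍ(Δ ≡ 1)` — on R1 = `W6.3.2` the PRINTED-HC locus of pub-hsemireg MT-TYPES-g6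 §8.4 (R1) [Abd16 App. A 2(b)]; count and pens theirs.
research route conditional on HC_CM; not a corollary; Q11.4-sentence-2 already refuted in dim ≥ 3. [cite: vanGeemen1994HodgeAV, (5.4.1)] -/
theorem t3_sl2_5_6A6A10A_d3_mk_detH_ne_split :
    (QuotientGroup.mk (Units.mk0 (((-416 : ℚ) / 25)) (by norm_num)) : weilNormResidueGroup 3) ≠
      splitDiscriminantClass 3 3 := by
  have e : Units.mk0 (((-416 : ℚ) / 25)) (by norm_num) = -(Units.mk0 ((416 : ℚ) / 25) (by norm_num)) := Units.ext (by norm_num)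
  rw [Ne, e, mk_neg_eq_splitDiscriminantClass_iff_of_odd (n := 3) (by decide)]
  have h := mul_not_mem_normUnitsSubgroup (mem_normUnitsSubgroup_of_sq_add_mul_sq (d := 3) (a := ((208 : ℚ) / 25)) (by norm_num) ((14 : ℚ) / 5) ((2 : ℚ) / 5) (by norm_num))
    Summit.HodgeConjecture.Ring2WeilNormDescent.two_not_mem_norm_three
  rw [mk0_mul_mk0] at h
  norm_num at h
  exact h

/-- The same datum, CELL IDENTIFICATION: `[det H|_B] = [-2]` in `ℚˣ/Nm(ℚ(√-3)ˣ)` — the census ROW KEY of `W6.3.2` (`a·2 = ((832 : ℚ) / 25) = (((28 : ℚ) / 5))² + 3·(((4 : ℚ) / 5))²`).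
research route conditional on HC_CM; not a corollary; Q11.4-sentence-2 already refuted in dim ≥ 3. [cite: vanGeemen1994HodgeAV, Lemma 5.2 (3)] -/
theorem t3_sl2_5_6A6A10A_d3_mk_detH_eq_key :
    (QuotientGroup.mk (Units.mk0 (-(((416 : ℚ) / 25))) (neg_ne_zero.2 (by norm_num))) : weilNormResidueGroup 3) =
      QuotientGroup.mk (Units.mk0 (-(2 : ℚ)) (neg_ne_zero.2 (by norm_num))) :=
  mk_neg_eq_mk_neg_of_mul_mem (by norm_num) (by norm_num)
    (mem_normUnitsSubgroup_of_sq_add_mul_sq _ ((28 : ℚ) / 5) ((4 : ℚ) / 5) (by norm_num))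

/-- TYPE-III WINDOW datum (census b04.17; engine `t3win.py`, exact): `G = SL₂(5)`, carrier `χ_{6} = Ind_B^G α₄` (rational, faithful, Schur index 2; `D_χ = (-1,-5)_Q`, finite ramification `[2]` — Hamilton's `ℍ_ℚ`), branch classes `(6A,6A,10A)` (orders `6,6,10`; `C̃` of genus 35); coset curve `Y = U\\C̃` of degree 24 and genus 7; `V = e_χ H¹(Y;ℚ) = H¹(B;ℚ)` (dimension 12; `B` the `χ`-HIDDEN FACTOR, an abelian SIXFOLD with `End⁰(B) ⊇ D` — TYPE III —, the Hecke image on `V` is `D` itself); for `K = ℚ(√-11) ⊂ D` the frame is the Hecke operator `x = 1·I + 1·J + 1·IJ` (`x² = -11`), `K`-signature `(3,3)` — WEIL TYPE —, literal `det H|_B = -1152`, `a = 1152`, `T(a) = [2, 11]`: row `W6.11.2` (NON-split); frame-free invariant `C = Nrd(cᵗ) = 9/400` (`Δ ≡ 1`; MT-TYPES-g6 §8.3: `δ(B,K) ≡ c_K·Δ`). This `B` is a point of the type-III locus `T_ℍ(Δ ≡ 1)` — on R1 = `W6.3.2` the PRINTED-HC locus of pub-hsemireg MT-TYPES-g6 §8.4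 (R1) [Abd16 App. A 2(b)]; count and pens theirs.
research route conditional on HC_CM; not a corollary; Q11.4-sentence-2 already refuted in dim ≥ 3. [cite: vanGeemen1994HodgeAV, (5.4.1)] -/
theorem t3_sl2_5_6A6A10A_d11_mk_detH_ne_split :
    (QuotientGroup.mk (Units.mk0 ((-1152 : ℚ)) (by norm_num)) : weilNormResidueGroup 11) ≠
      splitDiscriminantClass 3 11 := by
  have e : Units.mk0 ((-1152 : ℚ)) (by norm_num) = -(Units.mk0 (1152 : ℚ) (by norm_num)) := Units.ext (by norm_num)
  rw [Ne, e, mk_neg_eq_splitDiscriminantClass_iff_of_odd (n := 3) (by decide)]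
  have h := mul_not_mem_normUnitsSubgroup (mem_normUnitsSubgroup_of_sq_add_mul_sq (d := 11) (a := (576 : ℚ)) (by norm_num) (24 : ℚ) (0 : ℚ) (by norm_num))
    Summit.HodgeConjecture.Ring2WeilNormDescent.two_not_mem_norm_eleven
  rw [mk0_mul_mk0] at h
  norm_num at h
  exact h

/-- The same datum, CELL IDENTIFICATION: `[det H|_B] = [-2]` in `ℚˣ/Nm(ℚ(√-11)ˣ)` — the census ROW KEY of `W6.11.2` (`a·2 = (2304 : ℚ) = ((48 : ℚ))² + 11·((0 : ℚ))²`).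
research route conditional on HC_CM; not a corollary; Q11.4-sentence-2 already refuted in dim ≥ 3. [cite: vanGeemen1994HodgeAV, Lemma 5.2 (3)] -/
theorem t3_sl2_5_6A6A10A_d11_mk_detH_eq_key :
    (QuotientGroup.mk (Units.mk0 (-((1152 : ℚ))) (neg_ne_zero.2 (by norm_num))) : weilNormResidueGroup 11) =
      QuotientGroup.mk (Units.mk0 (-(2 : ℚ)) (neg_ne_zero.2 (by norm_num))) :=
  mk_neg_eq_mk_neg_of_mul_mem (by norm_num) (by norm_num)
    (mem_normUnitsSubgroup_of_sq_add_mul_sq _ (48 : ℚ) (0 : ℚ) (by norm_num))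

/-- TYPE-III WINDOW datum (census b04.17; engine `t3win.py`, exact): `G = SL₂(5)`, carrier `χ_{6} = Ind_B^G α₄` (rational, faithful, Schur index 2; `D_χ = (-1,-5)_Q`, finite ramification `[2]` — Hamilton's `ℍ_ℚ`), branch classes `(4A,5A,5A,5A)` (orders `4,5,5,5`; `C̃` of genus 70; a ONE-PARAMETER family, this is one member); coset curve `Y = U\\C̃` of degree 24 and genus 10; `V = e_χ H¹(Y;ℚ) = H¹(B;ℚ)` (dimension 12; `B` the `χ`-HIDDEN FACTOR, an abelian SIXFOLD with `End⁰(B) ⊇ D` — TYPE III —, the Hecke image on `V` is `D` itself); for `K = ℚ(√-3) ⊂ D` the frame is the Hecke operator `x = 1·I + 1/5·J + 3/5·IJ` (`x² = -3`), `K`-signature `(3,3)` — WEIL TYPE —, literal `det H|_B = -256/5`, `a = 256/5`, `T(a) = [3, 5]`: row `W6.3.5` (NON-split); frame-free invariant `C = Nrd(cᵗ) = 49/40` (`Δ ≡ 10`; MT-TYPES-g6 §8.3: `δ(B,K) ≡ c_K·Δ`).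
research route conditional on HC_CM; not a corollary; Q11.4-sentence-2 already refuted in dim ≥ 3. [cite: vanGeemen1994HodgeAV, (5.4.1)] -/
theorem t3_sl2_5_4A5A5A5A_d3_mk_detH_ne_split :
    (QuotientGroup.mk (Units.mk0 (((-256 : ℚ) / 5)) (by norm_num)) : weilNormResidueGroup 3) ≠
      splitDiscriminantClass 3 3 := by
  have e : Units.mk0 (((-256 : ℚ) / 5)) (by norm_num) = -(Units.mk0 ((256 : ℚ) / 5) (by norm_num)) := Units.ext (by norm_num)
  rw [Ne, e, mk_neg_eq_splitDiscriminantClass_iff_of_odd (n := 3) (by decide)]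
  have h := mul_not_mem_normUnitsSubgroup (mem_normUnitsSubgroup_of_sq_add_mul_sq (d := 3) (a := ((256 : ℚ) / 25)) (by norm_num) ((16 : ℚ) / 5) (0 : ℚ) (by norm_num))
    Summit.HodgeConjecture.Ring2WeilNormDescent.five_not_mem_norm_three
  rw [mk0_mul_mk0] at h
  norm_num at h
  exact h

/-- The same datum, CELL IDENTIFICATION: `[det H|_B] = [-5]` in `ℚˣ/Nm(ℚ(√-3)ˣ)` — the census ROW KEY of `W6.3.5` (`a·5 = (256 : ℚ) = ((16 : ℚ))² + 3·((0 : ℚ))²`).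
research route conditional on HC_CM; not a corollary; Q11.4-sentence-2 already refuted in dim ≥ 3. [cite: vanGeemen1994HodgeAV, Lemma 5.2 (3)] -/
theorem t3_sl2_5_4A5A5A5A_d3_mk_detH_eq_key :
    (QuotientGroup.mk (Units.mk0 (-(((256 : ℚ) / 5))) (neg_ne_zero.2 (by norm_num))) : weilNormResidueGroup 3) =
      QuotientGroup.mk (Units.mk0 (-(5 : ℚ)) (neg_ne_zero.2 (by norm_num))) :=
  mk_neg_eq_mk_neg_of_mul_mem (by norm_num) (by norm_num)
    (mem_normUnitsSubgroup_of_sq_add_mul_sq _ (16 : ℚ) (0 : ℚ) (by norm_num))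

/-- TYPE-III WINDOW datum (census b04.17; engine `t3win.py`, exact): `G = SL₂(5)`, carrier `χ_{6} = Ind_B^G α₄` (rational, faithful, Schur index 2; `D_χ = (-1,-5)_Q`, finite ramification `[2]` — Hamilton's `ℍ_ℚ`), branch classes `(4A,5A,5A,5A)` (orders `4,5,5,5`; `C̃` of genus 70; a ONE-PARAMETER family, this is one member); coset curve `Y = U\\C̃` of degree 24 and genus 10; `V = e_χ H¹(Y;ℚ) = H¹(B;ℚ)` (dimension 12; `B` the `χ`-HIDDEN FACTOR, an abelian SIXFOLD with `End⁰(B) ⊇ D` — TYPE III —, the Hecke image on `V` is `D` itself); for `K = ℚ(√-2) ⊂ D` the frame is the Hecke operator `x = 1·I + 1/5·J + 2/5·IJ` (`x² = -2`), `K`-signature `(3,3)` — WEIL TYPE —, literal `det H|_B = -59568/3125`, `a = 59568/3125`, `T(a) = [2, 5]`: row `W6.2.5` (NON-split); frame-free invariant `C = Nrd(cᵗ) = 49/40` (`Δ ≡ 10`; MT-TYPES-g6 §8.3: `δ(B,K) ≡ c_K·Δ`).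
research route conditional on HC_CM; not a corollary; Q11.4-sentence-2 already refuted in dim ≥ 3. [cite: vanGeemen1994HodgeAV, (5.4.1)] -/
theorem t3_sl2_5_4A5A5A5A_d2_mk_detH_ne_split :
    (QuotientGroup.mk (Units.mk0 (((-59568 : ℚ) / 3125)) (by norm_num)) : weilNormResidueGroup 2) ≠
      splitDiscriminantClass 3 2 := by
  have e : Units.mk0 (((-59568 : ℚ) / 3125)) (by norm_num) = -(Units.mk0 ((59568 : ℚ) / 3125) (by norm_num)) := Units.ext (by norm_num)
  rw [Ne, e, mk_neg_eq_splitDiscriminantClass_iff_of_odd (n := 3) (by decide)]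
  have h := mul_not_mem_normUnitsSubgroup (mem_normUnitsSubgroup_of_sq_add_mul_sq (d := 2) (a := ((59568 : ℚ) / 15625)) (by norm_num) ((-244 : ℚ) / 125) ((-4 : ℚ) / 125) (by norm_num))
    Summit.HodgeConjecture.Ring2WeilNormDescent.five_not_mem_norm_two
  rw [mk0_mul_mk0] at h
  norm_num at h
  exact h

/-- The same datum, CELL IDENTIFICATION: `[det H|_B] = [-5]` in `ℚˣ/Nm(ℚ(√-2)ˣ)` — the census ROW KEY of `W6.2.5` (`a·5 = ((59568 : ℚ) / 625) = (((-244 : ℚ) / 25))² + 2·(((-4 : ℚ) / 25))²`).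
research route conditional on HC_CM; not a corollary; Q11.4-sentence-2 already refuted in dim ≥ 3. [cite: vanGeemen1994HodgeAV, Lemma 5.2 (3)] -/
theorem t3_sl2_5_4A5A5A5A_d2_mk_detH_eq_key :
    (QuotientGroup.mk (Units.mk0 (-(((59568 : ℚ) / 3125))) (neg_ne_zero.2 (by norm_num))) : weilNormResidueGroup 2) =
      QuotientGroup.mk (Units.mk0 (-(5 : ℚ)) (neg_ne_zero.2 (by norm_num))) :=
  mk_neg_eq_mk_neg_of_mul_mem (by norm_num) (by norm_num)
    (mem_normUnitsSubgroup_of_sq_add_mul_sq _ ((-244 : ℚ) / 25) ((-4 : ℚ) / 25) (by norm_num))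

/-! ### §3 `SL₂(7)`, `χ₈` (`D_{3,∞}`): `W6.1.21` and `W6.7.3` -/

/-- TYPE-III WINDOW datum (census b04.17; engine `t3win.py`, exact): `G = SL₂(7)`, carrier `χ_{8} = Ind_B^G α₆` (rational, faithful, Schur index 2; `D_χ = (-3,-7)_Q`, finite ramification `[3]`), branch classes `(4A,6A,7A)` (orders `4,6,7`; `C̃` of genus 75); coset curve `Y = U\\C̃` of degree 48 and genus 9; `V = e_χ H¹(Y;ℚ) = H¹(B;ℚ)` (dimension 12; `B` the `χ`-HIDDEN FACTOR, an abelian SIXFOLD with `End⁰(B) ⊇ D` — TYPE III —, the Hecke image on `V` is `D` itself); for `K = ℚ(√-1) ⊂ D` the frame is the Hecke operator `x = 1·I + 1/7·J + 1/7·IJ` (`x² = -1`), `K`-signature `(3,3)` — WEIL TYPE —, literal `det H|_B = -24034671/4302592`, `a = 24034671/4302592`, `T(a) = [3, 7]`: row `W6.1.21` (NON-split); frame-free invariant `C = Nrd(cᵗ) = 4/7` (`Δ ≡ 7`; MT-TYPES-g6 §8.3: `δ(B,K) ≡ c_K·Δ`).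
research route conditional on HC_CM; not a corollary; Q11.4-sentence-2 already refuted in dim ≥ 3. [cite: vanGeemen1994HodgeAV, (5.4.1)] -/
theorem t3_sl2_7_4A6A7A_d1_mk_detH_ne_split :
    (QuotientGroup.mk (Units.mk0 (((-24034671 : ℚ) / 4302592)) (by norm_num)) : weilNormResidueGroup 1) ≠
      splitDiscriminantClass 3 1 := by
  have e : Units.mk0 (((-24034671 : ℚ) / 4302592)) (by norm_num) = -(Units.mk0 ((24034671 : ℚ) / 4302592) (by norm_num)) := Units.ext (by norm_num)
  rw [Ne, e, mk_neg_eq_splitDiscriminantClass_iff_of_odd (n := 3) (by decide)]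
  have h := mul_not_mem_normUnitsSubgroup (mem_normUnitsSubgroup_of_sq_add_mul_sq (d := 1) (a := ((8011557 : ℚ) / 30118144)) (by norm_num) ((333 : ℚ) / 2744) ((393 : ℚ) / 784) (by norm_num))
    Summit.HodgeConjecture.Ring2WeilNormDescent.twentyOne_not_mem_norm_one
  rw [mk0_mul_mk0] at h
  norm_num at h
  exact h

/-- The same datum, CELL IDENTIFICATION: `[det H|_B] = [-21]` in `ℚˣ/Nm(ℚ(√-1)ˣ)` — the census ROW KEY of `W6.1.21` (`a·21 = ((72104013 : ℚ) / 614656) = (((999 : ℚ) / 392))² + 1·(((1179 : ℚ) / 112))²`).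
research route conditional on HC_CM; not a corollary; Q11.4-sentence-2 already refuted in dim ≥ 3. [cite: vanGeemen1994HodgeAV, Lemma 5.2 (3)] -/
theorem t3_sl2_7_4A6A7A_d1_mk_detH_eq_key :
    (QuotientGroup.mk (Units.mk0 (-(((24034671 : ℚ) / 4302592))) (neg_ne_zero.2 (by norm_num))) : weilNormResidueGroup 1) =
      QuotientGroup.mk (Units.mk0 (-(21 : ℚ)) (neg_ne_zero.2 (by norm_num))) :=
  mk_neg_eq_mk_neg_of_mul_mem (by norm_num) (by norm_num)
    (mem_normUnitsSubgroup_of_sq_add_mul_sq _ ((999 : ℚ) / 392) ((1179 : ℚ) / 112) (by norm_num))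

/-- TYPE-III WINDOW datum (census b04.17; engine `t3win.py`, exact): `G = SL₂(7)`, carrier `χ_{8} = Ind_B^G α₆` (rational, faithful, Schur index 2; `D_χ = (-3,-7)_Q`, finite ramification `[3]`), branch classes `(4A,6A,7A)` (orders `4,6,7`; `C̃` of genus 75); coset curve `Y = U\\C̃` of degree 48 and genus 9; `V = e_χ H¹(Y;ℚ) = H¹(B;ℚ)` (dimension 12; `B` the `χ`-HIDDEN FACTOR, an abelian SIXFOLD with `End⁰(B) ⊇ D` — TYPE III —, the Hecke image on `V` is `D` itself); for `K = ℚ(√-7) ⊂ D` the frame is the Hecke operator `x = 0·I + 1·J + 0·IJ` (`x² = -7`), `K`-signature `(3,3)` — WEIL TYPE —, literal `det H|_B = -10233/4`, `a = 10233/4`, `T(a) = [3, 7]`: row `W6.7.3` (NON-split); frame-free invariant `C = Nrd(cᵗ) = 4/7` (`Δ ≡ 7`; MT-TYPES-g6 §8.3: `δ(B,K) ≡ c_K·Δ`).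
research route conditional on HC_CM; not a corollary; Q11.4-sentence-2 already refuted in dim ≥ 3. [cite: vanGeemen1994HodgeAV, (5.4.1)] -/
theorem t3_sl2_7_4A6A7A_d7_mk_detH_ne_split :
    (QuotientGroup.mk (Units.mk0 (((-10233 : ℚ) / 4)) (by norm_num)) : weilNormResidueGroup 7) ≠
      splitDiscriminantClass 3 7 := by
  have e : Units.mk0 (((-10233 : ℚ) / 4)) (by norm_num) = -(Units.mk0 ((10233 : ℚ) / 4) (by norm_num)) := Units.ext (by norm_num)
  rw [Ne, e, mk_neg_eq_splitDiscriminantClass_iff_of_odd (n := 3) (by decide)]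
  have h := mul_not_mem_normUnitsSubgroup (mem_normUnitsSubgroup_of_sq_add_mul_sq (d := 7) (a := ((3411 : ℚ) / 4)) (by norm_num) (9 : ℚ) ((21 : ℚ) / 2) (by norm_num))
    Summit.HodgeConjecture.Ring2WeilNormDescent.three_not_mem_norm_seven
  rw [mk0_mul_mk0] at h
  norm_num at h
  exact h

/-- The same datum, CELL IDENTIFICATION: `[det H|_B] = [-3]` in `ℚˣ/Nm(ℚ(√-7)ˣ)` — the census ROW KEY of `W6.7.3` (`a·3 = ((30699 : ℚ) / 4) = ((27 : ℚ))² + 7·(((63 : ℚ) / 2))²`).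
research route conditional on HC_CM; not a corollary; Q11.4-sentence-2 already refuted in dim ≥ 3. [cite: vanGeemen1994HodgeAV, Lemma 5.2 (3)] -/
theorem t3_sl2_7_4A6A7A_d7_mk_detH_eq_key :
    (QuotientGroup.mk (Units.mk0 (-(((10233 : ℚ) / 4))) (neg_ne_zero.2 (by norm_num))) : weilNormResidueGroup 7) =
      QuotientGroup.mk (Units.mk0 (-(3 : ℚ)) (neg_ne_zero.2 (by norm_num))) :=
  mk_neg_eq_mk_neg_of_mul_mem (by norm_num) (by norm_num)
    (mem_normUnitsSubgroup_of_sq_add_mul_sq _ (27 : ℚ) ((63 : ℚ) / 2) (by norm_num))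

end Summit.HodgeConjecture.HodgeConjecture.Ring2.WeilCoverage
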